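import Summits.CriticalPhenomena.PercolationContinuityZ3.Theorems.PercNearOneGluingNoHeavyQuantCatHullShiftCheck
import HarnessLib

/-!
# QUANT lane R8, T-DEC: THE EXACT `shift` CHECK, COMPLETE VERSION — the `G`-range of each cell is first clipped to where the slab meets the box
# (`Tab.shiftOK2`), so no point outside the polygon is tested; soundness as before

builds on p205010 (kernel theorem, internal audit signed; external expert review pending)

Support file (`--supports stmt-CriticalPhenomena-4575`), QUANT lane census seat prim-quant-census-2 (gen 78).  Definitions + theorems; standard
axioms, no sorries.  The `shift` field of `CatValueBoundS` for two tables `Ts` (offset `s`) and `Ts'` (offset `s' = s + δ`) sharing their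
`G`-grid reads `Ts'.Z G A + G·(ψ s' − ψ s) ≤ Ts.Z G (A + G·δ)`.  On a cell `(k,l)` of `Ts'` and for the `A`-cell `l'` of `Ts` containing `A + Gδ` the
difference of the two affine pieces is affine on the polygon `cell ∩ slab`; `Tab.shiftOK2` decides its nonnegativity from the values at the ends of
the two relevant boundary lines AFTER clipping the `G`-interval to `[(b₀−a₁)/δ, (b₁−a₀)/δ]` where the polygon lives (`Tab.shift_sound2`; `Tab.shiftOK` of
`…QuantCatHullShiftCheck` tested the unclipped ends and could reject valid tables — census-2 g78's LP tables at two of ten offsets).  [this work].  Nothing here is cited as a published result.  The gluing rows served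
[cite: KozmaNitzan2024, Conjecture 3 (p. 15)]; product measure [cite: Grimmett1999, §1.3 p. 10].
-/

noncomputable section

namespace Summit.CriticalPhenomena.PercolationContinuityZ3.Theorems
namespace Quant
namespace LawDec
namespace Tab

/-- the check for one `(k, l, l', j)`: the affine `D` is nonnegative on `cell(k,l) ∩ slab(l')`, the `G`-range clipped
to where the slab meets the box (`δ ≥ 1`). [this work] -/
def shiftCellOK2 (Ts Ts' : Tab) (δ : ℕ) (dψ : ℚ) (k l l' j : ℕ) : Bool :=
  let d := shiftD Ts Ts' δ dψ k l l' j
  let g0 := Ts'.gb.getD k 0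
  let g1 := Ts'.gb.getD (k + 1) 0
  let a0 := Ts'.ab.getD l 0
  let a1 := Ts'.ab.getD (l + 1) 0
  let b0 := Ts.ab.getD l' 0
  let b1 := Ts.ab.getD (l' + 1) 0
  let g0' := max g0 ((b0 - a1) / δ)
  let g1' := min g1 ((b1 - a0) / δ)
  decide (g1' < g0') ||
    (if 0 ≤ d.2.2 then lineOK d.1 d.2.1 d.2.2 a0 b0 δ g0' g1' ((b0 - a0) / δ) else lineOK d.1 d.2.1 d.2.2 a1 b1 δ g0' g1' ((b1 - a1) / δ))

/-- **the complete `shift` check** between `Ts` (offset `s`) and `Ts'` (offset `s' = s + δ`): all cells `(k,l)` of `Ts'`, all `A`-cells `l'` of `Ts` met by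
`A + Gδ`, all clamped terms `j ≤ k`. [this work] -/
def shiftOK2 (Ts Ts' : Tab) (δ : ℕ) (dψ : ℚ) : Bool :=
  decide (Ts.gb = Ts'.gb) &&
  (List.range (Ts'.gb.length - 1)).all fun k =>
    (List.range (Ts'.ab.length - 1)).all fun l =>
      let lo := idxQ Ts.ab (Ts'.ab.getD l 0 + Ts'.gb.getD k 0 * δ)
      let hi := idxQ Ts.ab (Ts'.ab.getD (l + 1) 0 + Ts'.gb.getD (k + 1) 0 * δ)
      (List.range (hi + 1 - lo)).all fun i => (List.range (k + 1)).all fun j => shiftCellOK2 Ts Ts' δ dψ k l (lo + i) j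

/-! ### Soundness -/

set_option maxHeartbeats 1600000 in
/-- **SOUNDNESS OF THE COMPLETE `shift` CHECK**: on the table domain, `Ts'.Z G A + G·dψ ≤ Ts.Z G (A + G·δ)`. [this work] -/
theorem shift_sound2 {Ts Ts' : Tab} {δ : ℕ} {dψ : ℚ} (h : shiftOK2 Ts Ts' δ dψ = true) (hδ : 0 < δ) (hw : Ts.wf = true) (hw' : Ts'.wf = true)
    {G A : ℝ} (hg0 : ((Ts'.gb.getD 0 0 : ℚ) : ℝ) ≤ G) (hg1 : G ≤ ((Ts'.gb.getLast?.getD 0 : ℚ) : ℝ))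
    (ha0 : ((Ts'.ab.getD 0 0 : ℚ) : ℝ) ≤ A) (ha1 : A ≤ ((Ts'.ab.getLast?.getD 0 : ℚ) : ℝ))
    (hb0 : ((Ts.ab.getD 0 0 : ℚ) : ℝ) ≤ A + G * δ) (hb1 : A + G * δ ≤ ((Ts.ab.getLast?.getD 0 : ℚ) : ℝ)) :
    Ts'.Z G A + G * dψ ≤ Ts.Z G (A + G * δ) := by
  have hwf := hw; have hwf' := hw'
  unfold wf at hw hw'
  simp only [Bool.and_eq_true, decide_eq_true_eq] at hw hw'
  obtain ⟨⟨⟨⟨⟨hlen, hsort⟩, halen⟩, _⟩, _⟩, hasort⟩ := hw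
  obtain ⟨⟨⟨⟨⟨hlen', hsort'⟩, halen'⟩, _⟩, _⟩, hasort'⟩ := hw'
  unfold shiftOK2 at h
  simp only [Bool.and_eq_true, decide_eq_true_eq] at h
  obtain ⟨hgb, hall⟩ := h
  -- indices of the point
  set k := idx Ts'.gb G with hk
  set l := idx Ts'.ab A with hl
  set l' := idx Ts.ab (A + G * δ) with hl'
  have hk2 : k + 2 ≤ Ts'.gb.length := idx_lt _ _ hlen'
  have hl2 : l + 2 ≤ Ts'.ab.length := idx_lt _ _ halen'
  have hl'2 : l' + 2 ≤ Ts.ab.length := idx_lt _ _ halen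
  -- cell bounds
  have cg0 : ((Ts'.gb.getD k 0 : ℚ) : ℝ) ≤ G := getD_idx_le _ _ hg0
  have cg1 : G ≤ ((Ts'.gb.getD (k + 1) 0 : ℚ) : ℝ) := le_getD_idx_succ _ _ hlen' hg1
  have ca0 : ((Ts'.ab.getD l 0 : ℚ) : ℝ) ≤ A := getD_idx_le _ _ ha0
  have ca1 : A ≤ ((Ts'.ab.getD (l + 1) 0 : ℚ) : ℝ) := le_getD_idx_succ _ _ halen' ha1
  have cb0 : ((Ts.ab.getD l' 0 : ℚ) : ℝ) ≤ A + G * δ := getD_idx_le _ _ hb0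
  have cb1 : A + G * δ ≤ ((Ts.ab.getD (l' + 1) 0 : ℚ) : ℝ) := le_getD_idx_succ _ _ halen hb1
  -- l' lies in the checked range
  set lo := idxQ Ts.ab (Ts'.ab.getD l 0 + Ts'.gb.getD k 0 * δ) with hlo
  set hi := idxQ Ts.ab (Ts'.ab.getD (l + 1) 0 + Ts'.gb.getD (k + 1) 0 * δ) with hhi
  have hδ0 : (0 : ℝ) ≤ δ := Nat.cast_nonneg δ
  have hlol' : lo ≤ l' := by
    rw [hlo, ← idx_cast, hl']
    refine idx_mono _ ?_; push_cast; nlinarith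
  have hl'hi : l' ≤ hi := by
    rw [hhi, ← idx_cast, hl']
    refine idx_mono _ ?_; push_cast; nlinarith
  -- extract the check for (k, l, l', j)
  rw [List.all_eq_true] at hall
  have hK := hall k (List.mem_range.2 (by omega)); rw [List.all_eq_true] at hK
  have hL := hK l (List.mem_range.2 (by omega)); rw [List.all_eq_true] at hL
  have hI := hL (l' - lo) (List.mem_range.2 (by omega)); rw [List.all_eq_true] at hI
  have hlo' : lo + (l' - lo) = l' := by omega
  -- RHS ≥ own piece of Ts at (k, l')
  have hkR : idx Ts.gb G = k := by rw [hk, hgb]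
  have rhs_ge : Ts.term l' G (A + G * δ) k ≤ Ts.Z G (A + G * δ) := by
    have := Z_ge_term Ts G (A + G * δ); rwa [hkR] at this
  -- G ≤ gb[k+1] so the own term of Ts at k is the plain piece
  have eqg : Ts.gb.getD (k + 1) 1 = Ts'.gb.getD (k + 1) 0 := by
    rw [hgb, List.getD_eq_getElem _ _ (by omega : k + 1 < Ts'.gb.length), List.getD_eq_getElem _ _ (by omega : k + 1 < Ts'.gb.length)]
  have hmin : min G ((Ts.gb.getD (k + 1) 1 : ℚ) : ℝ) = G := min_eq_left (by rw [eqg]; exact cg1)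
  -- bound every clamped term of Ts'
  have key : ∀ j, j ≤ k → Ts'.term l G A j ≤ Ts.term l' G (A + G * δ) k - G * dψ := by
    intro j hj
    have hc := hI j (List.mem_range.2 (Nat.lt_succ_of_le hj))
    rw [hlo'] at hc
    unfold shiftCellOK2 at hc
    -- the clipped G-range contains G
    have hδR : (0 : ℝ) < (δ : ℝ) := by exact_mod_cast hδ
    have cg0' : ((max (Ts'.gb.getD k 0) ((Ts.ab.getD l' 0 - Ts'.ab.getD (l + 1) 0) / δ) : ℚ) : ℝ) ≤ G := by
      push_cast
      refine max_le cg0 ?_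
      rw [div_le_iff₀ hδR]; linarith
    have cg1' : G ≤ ((min (Ts'.gb.getD (k + 1) 0) ((Ts.ab.getD (l' + 1) 0 - Ts'.ab.getD l 0) / δ) : ℚ) : ℝ) := by
      push_cast
      refine le_min cg1 ?_
      rw [le_div_iff₀ hδR]; linarith
    simp only [Bool.or_eq_true, decide_eq_true_eq] at hc
    rcases hc with hvac | hc
    · exfalso
      have : ((min (Ts'.gb.getD (k + 1) 0) ((Ts.ab.getD (l' + 1) 0 - Ts'.ab.getD l 0) / δ) : ℚ) : ℝ)
          < ((max (Ts'.gb.getD k 0) ((Ts.ab.getD l' 0 - Ts'.ab.getD (l + 1) 0) / δ) : ℚ) : ℝ) := by exact_mod_cast hvac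
      linarith
    unfold term ev
    rw [hmin]
    by_cases hjk : j < k
    · -- earlier cell: the clamped reach is gb[j+1] ≤ G
      have hle : ((Ts'.gb.getD (j + 1) 1 : ℚ) : ℝ) ≤ G := by
        have e1 : Ts'.gb.getD (j + 1) 1 = Ts'.gb.getD (j + 1) 0 := by
          rw [List.getD_eq_getElem _ _ (by omega : j + 1 < Ts'.gb.length), List.getD_eq_getElem _ _ (by omega : j + 1 < Ts'.gb.length)]
        rw [e1]
        refine le_trans ?_ cg0
        exact_mod_cast getD_mono hsort' (by omega : j + 1 ≤ k) (by omega)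
      rw [min_eq_right hle]
      simp only [shiftD, if_pos hjk] at hc
      by_cases hd : 0 ≤ (Ts.pc k l').2.2 - (Ts'.pc j l).2.2
      · rw [if_pos hd] at hc
        have := lineOK_sound hc cg0' cg1' (Or.inl ⟨by exact_mod_cast hd, ca0, by linarith⟩)
        push_cast at this; nlinarith
      · rw [if_neg hd] at hc
        have hd' : (Ts.pc k l').2.2 - (Ts'.pc j l).2.2 ≤ 0 := (not_le.1 hd).le
        have := lineOK_sound hc cg0' cg1' (Or.inr ⟨by exact_mod_cast hd', ca1, by linarith⟩)
        push_cast at this; nlinarith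
    · -- own cell j = k
      have hjk' : j = k := le_antisymm hj (not_lt.1 hjk)
      rw [hjk']
      have hgj : ((Ts'.gb.getD (k + 1) 1 : ℚ) : ℝ) = ((Ts'.gb.getD (k + 1) 0 : ℚ) : ℝ) := by
        rw [List.getD_eq_getElem _ _ (by omega : k + 1 < Ts'.gb.length), List.getD_eq_getElem _ _ (by omega : k + 1 < Ts'.gb.length)]
      have hmin' : min G ((Ts'.gb.getD (k + 1) 1 : ℚ) : ℝ) = G := min_eq_left (by rw [hgj]; exact cg1)
      rw [hmin']
      rw [hjk'] at hc
      simp only [shiftD, lt_irrefl, if_false] at hc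
      by_cases hd : 0 ≤ (Ts.pc k l').2.2 - (Ts'.pc k l).2.2
      · rw [if_pos hd] at hc
        have := lineOK_sound hc cg0' cg1' (Or.inl ⟨by exact_mod_cast hd, ca0, by linarith⟩)
        push_cast at this; nlinarith
      · rw [if_neg hd] at hc
        have hd' : (Ts.pc k l').2.2 - (Ts'.pc k l).2.2 ≤ 0 := (not_le.1 hd).le
        have := lineOK_sound hc cg0' cg1' (Or.inr ⟨by exact_mod_cast hd', ca1, by linarith⟩)
        push_cast at this; nlinarith
  have hz : Ts'.Z G A ≤ Ts.term l' G (A + G * δ) k - G * dψ := by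
    unfold Z; rw [← hk, ← hl]
    exact zaux_le Ts' l G A _ k key
  linarith

end Tab
end LawDec
end Quant
end Summit.CriticalPhenomena.PercolationContinuityZ3.Theorems
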